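import Literature.AlgebraicGeometry.Frobenioids.ArchimedeanPerfectionBiratSection
import Literature.AlgebraicGeometry.Frobenioids.ArchimedeanIsometrization
import Mathlib.Analysis.SpecialFunctions.Log.Basic
import HarnessLib

/-!
# Frobenioids II, Thm. 3.6 (i) at `Λ = ℚ`, piece P2 (ii b): the RADIAL SECTION of the divisor map of
# `O^×((A, n)^birat)` in `C^ℚ = C^pf` — germs of positive real scalars

Mochizuki, *The geometry of Frobenioids II: poly-Frobenioids*, Kyushu J. Math. **62** (2008) 401–460, §3,
Thm. 3.6 (i) p. 36 ("rational function monoid naturally isomorphic to `(Φ^fld)^Λ`"; `Φ^fld = Φ^gp × Φ^∡`, the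
`Φ^gp`-coordinate = the radial part `ord(K^×) ≅ ℝ_{>0}` of Def. 3.1 (ii) p. 23) [cite: MochizukiFrdII2008, Thm 3.6 (i) p.36];
[FrdI] Prop. 4.4 (i)/(iii) p. 83–84 (the divisor map `O^×(A^birat) → Φ^gp(A)`, "a surjection
`O^×(A^birat) ↠ Φ^birat`") [cite: MochizukiFrdI2008, Prop. 4.4 (iii) p.83].

abc-iut cell, layer L1, row M13-c3 piece **P2** (seat abc-iut-w5-d246), file 2b of the P2 chain: over file 2's
germ homomorphism `germHom : K^× →* O^×(X^birat)` (`X = (A, n)`, naively isotropic Frobenius level `c`), the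
monoid homomorphism **`radialSection X hPf hc : Φ(Base A) = ℝ_{≥0} →* O^×(X^birat)`**, `a ↦ germ (e^{−(n c)·a})`
(a positive real scalar), whose divisor is EXACTLY the class of `a`: **`divHom_radialSection`**:
`divHom (radialSection a) = [a] = of (of a) ∈ Φ^pf(Base A)^gp` — the monoid-level section `σ₀` consumed by
abc-iut-w5-d194's `gpPerfSection` (BiratUnitsPerfectSections.lean, hypothesis `∀ a, δ (σ₀ a) = of (of a)`) and
abc-iut-L1-t6's `isoOfSection` (ArchimedeanPerfectionRationalFunctionMonoid.lean).  One data def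
(`radialSection`); nothing here bears on [IUTchIII] Cor. 3.12.
-/

noncomputable section

namespace Literature.AlgebraicGeometry.Frobenioids

open CategoryTheory Opposite
open scoped NNReal

universe v u

namespace ArchFrd

namespace Thm36Sub

variable {D : Type u} [Category.{v} D] {π : D ⥤ D0}

open PreFrobenioid PreFrobenioid.Perfection

variable {hF : PreFrobenioid.IsFrobenioid (C.toElem π)} (X : pfCat π hF)
  (hPf : PreFrobenioid.IsFrobenioid (pfStr π hF)) {c : ℕ+} (hc : (frobPow hF X.obj c).fst.IsNaivelyIsotropic)

/-- The germ only depends on the scalar (not on the membership proof). [cite: MochizukiFrdI2008, Prop. 4.4 (iv) p.83] -/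
theorem germ_congr {z z' : ℂˣ} (e : z = z') (hz : z ∈ D0.scalars (frobPow hF X.obj c).fst.base)
    (hz' : z' ∈ D0.scalars (frobPow hF X.obj c).fst.base) : germ X hPf hc z hz = germ X hPf hc z' hz' := by
  subst e; rfl

/-- The positive real number `exp(−(n·c)·a)` for `a ∈ ℝ_{≥0} = Φ` (`X = (A, n)`, level `c`).
[cite: MochizukiFrdII2008, Def 3.1 (ii) p.23] -/
def radialScalar (a : Multiplicative ℝ≥0) : PosReal :=
  ⟨Real.exp (-((((X.idx * c : ℕ+) : ℕ) : ℝ) * ((Multiplicative.toAdd a : ℝ≥0) : ℝ))), Real.exp_pos _⟩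

omit hc in
/-- `exp(−N·0) = 1`. [cite: MochizukiFrdII2008, Def 3.1 (ii) p.23] -/
theorem radialScalar_one : ofPosReal ℂ (radialScalar X (c := c) 1) = 1 := by
  apply Units.ext
  rw [coe_ofPosReal, Units.val_one]
  change ((Real.exp (-( _ * ((Multiplicative.toAdd (1 : Multiplicative ℝ≥0) : ℝ≥0) : ℝ))) : ℝ) : ℂ) = 1
  rw [toAdd_one, NNReal.coe_zero, mul_zero, neg_zero, Real.exp_zero, Complex.ofReal_one]

omit hc in
/-- `exp(−N(a+b)) = exp(−Na)·exp(−Nb)`. [cite: MochizukiFrdII2008, Def 3.1 (ii) p.23] -/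
theorem radialScalar_mul (a b : Multiplicative ℝ≥0) :
    ofPosReal ℂ (radialScalar X (c := c) (a * b)) =
      ofPosReal ℂ (radialScalar X (c := c) a) * ofPosReal ℂ (radialScalar X (c := c) b) := by
  rw [← map_mul]
  congr 1
  apply Subtype.ext
  change Real.exp _ = Real.exp _ * Real.exp _
  rw [← Real.exp_add, toAdd_mul, NNReal.coe_add]
  ring_nf

/-- **The radial section `σ₀ : Φ(Base A) = ℝ_{≥0} →* O^×((A, n)^birat)`**, `a ↦ germ (e^{−(n·c)·a})`: the germs of
the POSITIVE REAL scalars (the `ord(K^×) ≅ ℝ_{>0}`-coordinate of `K^× = O_K^× × ord(K^×)`, Def. 3.1 (ii)),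
normalised so that the divisor of `σ₀(a)` is the class of `a` (`divHom_radialSection`).
[cite: MochizukiFrdII2008, Thm 3.6 (i) p.36] -/
def radialSection : Multiplicative ℝ≥0 →* BiratUnits (pfStr π hF) hPf X where
  toFun a := germ X hPf hc (ofPosReal ℂ (radialScalar X (c := c) a)) (ofPosReal_mem_scalars _ _)
  map_one' := by
    rw [germ_congr X hPf hc (radialScalar_one X (c := c)) _ (one_mem _)]
    exact germ_one X hPf hc
  map_mul' a b := by
    rw [germ_mul, germ_congr X hPf hc (radialScalar_mul X (c := c) a b) _
      (mul_mem (ofPosReal_mem_scalars _ _) (ofPosReal_mem_scalars _ _))]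

/-- `radialSection a = germ (e^{−(n c) a})`. [cite: MochizukiFrdII2008, Thm 3.6 (i) p.36] -/
theorem radialSection_apply (a : Multiplicative ℝ≥0) :
    radialSection X hPf hc a =
      germ X hPf hc (ofPosReal ℂ (radialScalar X (c := c) a)) (ofPosReal_mem_scalars _ _) := rfl

/-- The divisors of the two scalar arrows of the standard fraction of `e^{−N a}`: `Div(ι_z) = Div(ι_1) + N·a` in
`ℝ_{≥0}` (`log(tip/(|z| t)) = log(tip/t) − log |z|`). [cite: MochizukiFrdII2008, Ex 3.3 (i) p.28] -/
theorem div_discIncl_radialScalar (a : Multiplicative ℝ≥0) (t : PosReal)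
    (h : ‖((ofPosReal ℂ (radialScalar X (c := c) a) : ℂˣ) : ℂ)‖ * t ≤ (frobPow hF X.obj c).fst.tip)
    (h₁ : ‖((1 : ℂˣ) : ℂ)‖ * t ≤ (frobPow hF X.obj c).fst.tip) :
    C0.div (discIncl (frobPow hF X.obj c) hc t (ofPosReal ℂ (radialScalar X (c := c) a))
        (ofPosReal_mem_scalars _ _) h).fst =
      C0.div (discIncl (frobPow hF X.obj c) hc t 1 (one_mem _) h₁).fst * a ^ ((X.idx * c : ℕ+) : ℕ) := by
  apply Multiplicative.toAdd.injective
  apply NNReal.eq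
  rw [toAdd_mul, toAdd_pow, NNReal.coe_add, NNReal.coe_nsmul]
  change ((Multiplicative.toAdd (PreFrobenioid.Div (C.toElem π) (discIncl _ hc t _ _ h)) : ℝ≥0) : ℝ) =
    ((Multiplicative.toAdd (PreFrobenioid.Div (C.toElem π) (discIncl _ hc t 1 _ h₁)) : ℝ≥0) : ℝ) + _
  rw [toAdd_div_discIncl, toAdd_div_discIncl, C0.norm_coe_ofPosReal, Units.val_one, norm_one, one_mul]
  have hT := C0.tip_pos (frobPow hF X.obj c).fst
  have ht := t.2
  have hr := (radialScalar X (c := c) a).2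
  rw [Real.log_div hT.ne' (mul_pos hr ht).ne', Real.log_mul hr.ne' ht.ne', Real.log_div hT.ne' ht.ne',
    show ((radialScalar X (c := c) a : PosReal) : ℝ) = Real.exp (-((((X.idx * c : ℕ+) : ℕ) : ℝ) *
      ((Multiplicative.toAdd a : ℝ≥0) : ℝ))) from rfl, Real.log_exp, nsmul_eq_mul]
  ring

/-- **The divisor of the radial section is the identity**: `divHom (σ₀ a) = [a] = of (of a)` in
`Φ^pf(Base A)^gp` ([FrdI] Prop. 4.4 (i): `(φ^*)⁻¹Div φ − (α^*)⁻¹Div α = (Div ι_1 + N a) − Div ι_1` at index `N = n·c`,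
and `(a^N)^{1/N} = a`) — the hypothesis `∀ a, δ (σ₀ a) = of (of a)` of abc-iut-w5-d194's `apply_gpPerfSection`.
[cite: MochizukiFrdI2008, Prop. 4.4 (i) p.84] -/
theorem divHom_radialSection (a : Multiplicative ℝ≥0) :
    BiratUnits.divHom hPf X (radialSection X hPf hc a) =
      Algebra.GrothendieckGroup.of (Frobenioids.Perfection.of ((Φ π).obj (op X.obj.snd)) a) := by
  have e := div_discIncl_radialScalar X hc a (rad (frobPow hF X.obj c) (ofPosReal ℂ (radialScalar X (c := c) a)))
    (norm_mul_rad_le _ _) (norm_one_mul_le (rad_le _ _))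
  rw [radialSection_apply, divHom_germ]
  change (Algebra.GrothendieckGroup.of (Frobenioids.Perfection.mk (M := Multiplicative ℝ≥0)
        (C0.div (discIncl (frobPow hF X.obj c) hc _ (ofPosReal ℂ (radialScalar X (c := c) a)) _ _).fst)
        (X.idx * c * 1)) /
      Algebra.GrothendieckGroup.of (Frobenioids.Perfection.mk (M := Multiplicative ℝ≥0)
        (C0.div (discIncl (frobPow hF X.obj c) hc _ 1 (one_mem _) _).fst) (X.idx * c * 1)) :
      Algebra.GrothendieckGroup (Frobenioids.Perfection (Multiplicative ℝ≥0))) =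
    Algebra.GrothendieckGroup.of (Frobenioids.Perfection.of (Multiplicative ℝ≥0) a)
  rw [div_eq_iff_eq_mul, ← map_mul, e]
  congr 1
  rw [Frobenioids.Perfection.of_apply, Frobenioids.Perfection.mk_mul_mk]
  refine Frobenioids.Perfection.mk_eq_mk_iff.mpr ⟨1, ?_⟩
  simp only [PNat.mul_coe, PNat.one_coe, one_mul, mul_one, pow_one]
  rw [mul_comm]

end Thm36Sub

end ArchFrd

end Literature.AlgebraicGeometry.Frobenioids

end
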